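import Mathlib
import Summits.ResolutionOfSingularities.ResolutionOfSingularities.Theorems.WildQuotientsWildQuotientResolutionS1PlanarFieldDefs
import Summits.ResolutionOfSingularities.ResolutionOfSingularities.Theorems.WildConesClassicalRegimesStubMuDropCharTwoOrdPNoether
import Literature.RingTheory.MvPowerSeries.FiniteColength
-- (W-4a) the step tools (Part I of idea-1 `w1n/S1W1NOStep.lean` a13dd1fd4a17bec2 = `w1n/S1W1NStepTools.lean`):
import Summits.ResolutionOfSingularities.ResolutionOfSingularities.Theorems.WildQuotientsWildQuotientResolutionS1W1NStepTools
-- (W-3) the B3 transport toolkit (idea-1 `w1n/S1W1NTransport.lean` 5281fd5e869a68b1, split by the filer into three files;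
-- the last one, `…TransportSwap`, carries `forall_isSucc_of_chart1_zero` and imports the other two):
import Summits.ResolutionOfSingularities.ResolutionOfSingularities.Theorems.WildQuotientsWildQuotientResolutionS1PlanarFieldTransportSwap

/-!
# S1 / W1N cascade — the support `OStep`: the Milnor number drops at a type-O step

Crux stmt-ResolutionOfSingularities-17941 (`WildQuotients.CyclicQuotientFourfolds`), S1a line `s1a-logminvertex`,
stub `stub_W1N_print`, sub-line `w1n-cascade` (idea-1 `W1N-LINE.md`, plan `OSTEP-PLAN.md`).
[OURS · L1 W4.5c] — NOT a statement of the manuscript; counted 0 post-V5.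

* Part II — `OStep0` = `milnor_lt_of_isSuccChart1_zero`: at a chart-1 step at `c = 0` from an isolated node
  with `linearPart = 0` (both components of order `≥ 2`) to an ISOLATED successor, the Milnor number drops.
  Proof: the `g`-device (`x·b' = g∘B / x^{mg}` with `g = x·b − y·a`), the colength identity
  `(mg−1)·fA + I(A,G) = mb·fA + I(A,B*)` (`colength_identity`), the tree's Noether inequality
  `I(A,B*) + ma·mb ≤ μ` and the case arithmetic `ostep_arith` (cases N1 `ma ≤ mb`, N2 `mb < ma`, D `x ∣` both).
* Part III — `milnor_lt_of_isSucc` = the support `W1NCascade.OStep` unfolded, for an ARBITRARY successor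
  (chart 1 at any `c`, chart 2), by the B3 transport `forall_isSucc_of_chart1_zero` (shear / swap invariance of
  `milnor`, `IsIsolated`, `IsBadNode`, `linearPart = 0`).

Discharge of the support (one line, in the registering seat's file):
`theorem oStep : W1NCascade.OStep := fun _ _ θ θ' => PlanarField.milnor_lt_of_isSucc θ θ'`.
-/

-- single-problem summit: the doubled namespace component `ResolutionOfSingularities` is forced
set_option linter.dupNamespace false

noncomputable section

open MvPowerSeries IsLocalRing
open Literature.AlgebraicGeometry.Resolution
open Summit.ResolutionOfSingularities.ResolutionOfSingularities.Theorems.WildCones.MuDropCharTwoOrdP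

namespace Summit.ResolutionOfSingularities.ResolutionOfSingularities.Theorems.WildQuotientResolution.S1.PlanarField

variable {κ : Type} [Field κ]

/-! ## Part II — `OStep0`: at a chart-1 step at `0` from an isolated node with `linearPart = 0`,
the Milnor number drops (OSTEP-PLAN §2–§3). [OURS · L1 W4.5c] -/

/-- A variable is a non-zero power series. -/
theorem X_ne_zero' {σ : Type} [DecidableEq σ] (t : σ) : (X t : MvPowerSeries σ κ) ≠ 0 := fun h => by
  classical
  have := congrArg (coeff (Finsupp.single t 1)) h
  rw [coeff_X, if_pos rfl, map_zero] at this
  exact one_ne_zero this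

/-- `ord (x·b − y·a) ≥ min (ord a) (ord b) + 1`. [folklore] -/
theorem min_order_add_one_le (a b : MvPowerSeries (Fin 2) κ) :
    min a.order b.order + 1 ≤ (X 0 * b - X 1 * a).order := by
  have hX : ∀ t : Fin 2, (X t : MvPowerSeries (Fin 2) κ).order = 1 := fun t => by
    rw [X_def, order_monomial_of_ne_zero one_ne_zero, Finsupp.degree_single, Nat.cast_one]
  rw [sub_eq_add_neg]
  refine le_trans ?_ min_order_le_add
  rw [order_neg]
  have h1 : min a.order b.order + 1 = min (1 + b.order) (1 + a.order) := by
    rw [min_add_add_left, min_comm, add_comm]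
  rw [h1]
  exact min_le_min (by rw [← hX 0]; exact le_order_mul) (by rw [← hX 1]; exact le_order_mul)

/-- `g := x·b − y·a ≠ 0` for an isolated node with `ord a ≥ 2` (else `(a, b) ⊆ (a/x)`). [OURS · L1 W4.5c] -/
theorem X_mul_sub_ne_zero (θ : PlanarField κ) (hiso : θ.IsIsolated) (h2 : 2 ≤ θ.a.order) :
    X 0 * θ.b - X 1 * θ.a ≠ 0 := by
  set e : Fin 1 ↪ Fin 2 := ⟨fun _ => (1 : Fin 2), fun a b _ => Subsingleton.elim a b⟩ with he
  intro hg
  have hab : X 0 * θ.b = X 1 * θ.a := sub_eq_zero.mp hg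
  have hKa : killCompl e θ.a = 0 := by
    have h1 : killCompl e (X 0 * θ.b) = 0 := by
      rw [map_mul, killCompl_X_eq_zero (fun ⟨i, hi⟩ => by simp [he] at hi), zero_mul]
    have hX1 : killCompl e (X (1 : Fin 2) : MvPowerSeries (Fin 2) κ) = (X 0 : MvPowerSeries (Fin 1) κ) :=
      killCompl_X (R := κ) (e := e) 0
    rw [hab, map_mul, hX1] at h1
    rcases mul_eq_zero.mp h1 with h | h
    · exact absurd h (X_ne_zero' (κ := κ) (0 : Fin 1))
    · exact h
  have hxa : (X 0 : MvPowerSeries (Fin 2) κ) ∣ θ.a := by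
    by_contra hnd
    exact ((killCompl_ne_zero_iff_not_X_dvd θ.a).mpr hnd) hKa
  obtain ⟨a₁, ha₁⟩ := hxa
  have hb : θ.b = X 1 * a₁ := by
    apply mul_left_cancel₀ (X_zero_ne_zero (κ := κ))
    rw [hab, ha₁]; ring
  have ha₁0 : constantCoeff a₁ = 0 := by
    have hc : coeff (Finsupp.single (0 : Fin 2) 1) θ.a = 0 :=
      ((FormalCoordChange.two_le_order_iff θ.a).mp h2).2 0
    rw [ha₁, X_def, coeff_monomial_mul, if_pos le_rfl, tsub_self, one_mul,
      coeff_zero_eq_constantCoeff_apply] at hc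
    exact hc
  have hle : Ideal.span ({θ.a, θ.b} : Set (MvPowerSeries (Fin 2) κ)) ≤
      Ideal.span ((({a₁} : Finset (MvPowerSeries (Fin 2) κ)) : Set (MvPowerSeries (Fin 2) κ))) := by
    rw [Finset.coe_singleton, Ideal.span_le]
    intro z hz
    simp only [Set.mem_insert_iff, Set.mem_singleton_iff] at hz
    rcases hz with rfl | rfl
    · exact Ideal.mem_span_singleton.mpr ⟨X 0, by rw [ha₁, mul_comm]⟩
    · exact Ideal.mem_span_singleton.mpr ⟨X 1, by rw [hb, mul_comm]⟩
  refine not_finite_quot_of_le_span {a₁} ?_ (by simp) hle hiso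
  rw [Finset.coe_singleton, Set.singleton_subset_iff]
  exact mem_maximalIdeal_of_constantCoeff_eq_zero ha₁0

/-- THE COLENGTH IDENTITY (OSTEP-PLAN §2 step 8): from `x^k·G = x^mb·B* − y·x^ma·A` (so
`(A, x^k G) = (A, x^mb B*)`), `k·fA + I(A,G) = mb·fA + I(A,B*)` with `fA = dim/(A, x)`, and `/(A, B*)` is finite
as soon as `/(A, G)` is. [OURS · L1 W4.5c] -/
theorem colength_identity {A Bst G : MvPowerSeries (Fin 2) κ} {ma mb k : ℕ}
    (hKA : killCompl (⟨fun _ => (1 : Fin 2), fun a b _ => Subsingleton.elim a b⟩ : Fin 1 ↪ Fin 2) A ≠ 0)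
    (hid : X 0 ^ k * G = X 0 ^ mb * Bst - X 1 * X 0 ^ ma * A)
    (hfinAG : Module.Finite κ (MvPowerSeries (Fin 2) κ ⧸ Ideal.span {A, G})) :
    Module.Finite κ (MvPowerSeries (Fin 2) κ ⧸ Ideal.span {A, Bst}) ∧
    k * Module.finrank κ (MvPowerSeries (Fin 2) κ ⧸ Ideal.span {A, (X 0 : MvPowerSeries (Fin 2) κ)}) +
        Module.finrank κ (MvPowerSeries (Fin 2) κ ⧸ Ideal.span {A, G}) =
      mb * Module.finrank κ (MvPowerSeries (Fin 2) κ ⧸ Ideal.span {A, (X 0 : MvPowerSeries (Fin 2) κ)}) +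
        Module.finrank κ (MvPowerSeries (Fin 2) κ ⧸ Ideal.span {A, Bst}) := by
  have hxA : ¬ (X 0 : MvPowerSeries (Fin 2) κ) ∣ A := (killCompl_ne_zero_iff_not_X_dvd A).mp hKA
  have hfinAx : Module.Finite κ (MvPowerSeries (Fin 2) κ ⧸ Ideal.span {A, (X 0 : MvPowerSeries (Fin 2) κ)}) := by
    rw [Ideal.span_pair_comm]; exact (colength_X_eq_order hKA).1
  have hfin1 : Module.Finite κ (MvPowerSeries (Fin 2) κ ⧸ Ideal.span {A, X 0 ^ k * G}) :=
    finite_quot_span_pair_X_pow_mul k hfinAx hfinAG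
  have hideal : Ideal.span ({A, X 0 ^ k * G} : Set (MvPowerSeries (Fin 2) κ)) = Ideal.span {A, X 0 ^ mb * Bst} := by
    rw [hid, Ideal.span_pair_sub_mul_left]
  have hfin2 : Module.Finite κ (MvPowerSeries (Fin 2) κ ⧸ Ideal.span {A, X 0 ^ mb * Bst}) := by
    rw [← hideal]; exact hfin1
  obtain ⟨hfinAB, h2⟩ := colength_X_pow_mul hxA mb hfin2
  obtain ⟨-, h1⟩ := colength_X_pow_mul hxA k hfin1
  have heq : Module.finrank κ (MvPowerSeries (Fin 2) κ ⧸ Ideal.span {A, X 0 ^ k * G}) =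
      Module.finrank κ (MvPowerSeries (Fin 2) κ ⧸ Ideal.span {A, X 0 ^ mb * Bst}) := by
    rw [hideal]
  exact ⟨hfinAB, by rw [← h1, heq, h2]⟩

/-- The final arithmetic of `OStep0` (OSTEP-PLAN §3: cases N1 / N2 / D). [OURS · L1 W4.5c] -/
theorem ostep_arith {μ μ' ma mb mg s α β fA eG IAG IAB : ℕ}
    (h2a : 2 ≤ ma) (h2b : 2 ≤ mb) (hmg : min ma mb + 1 ≤ mg)
    (hsα : s + α = ma) (hsβ : s + 2 + β = mg) (hsat : α = 0 ∨ β = 0)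
    (hF1 : IAB + ma * mb ≤ μ) (hF2 : (s + 1 + β) * fA + IAG = mb * fA + IAB)
    (hF3 : fA ≤ ma) (hF4 : eG ≤ mg) (hN2 : mb < ma → mg = mb + 1 ∧ eG ≤ mb)
    (hμ' : μ' = α * eG + β * fA + IAG) : μ' < μ := by
  rcases Nat.lt_or_ge mb ma with hab | hab
  · -- mb < ma : case N2 (case D is impossible here)
    obtain ⟨hmg1, heG⟩ := hN2 hab
    obtain ⟨d, rfl⟩ : ∃ d, ma = mb + d := ⟨ma - mb, by omega⟩
    rcases hsat with hα | hβ
    · exfalso; omega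
    · subst hβ
      have hs : s + 1 = mb := by omega
      have hαe : α * eG ≤ α * mb := Nat.mul_le_mul_left α heG
      refine lt_of_not_ge fun hcon => ?_
      nlinarith [hcon, hF1, hF2, hμ', hαe, hs, hsα]
  · -- ma ≤ mb : cases N1 and D
    obtain ⟨d, rfl⟩ : ∃ d, mb = ma + d := ⟨mb - ma, by omega⟩
    have hmg' : ma + 1 ≤ mg := by
      rw [min_eq_left (by omega)] at hmg; exact hmg
    have hd : d * fA ≤ d * ma := Nat.mul_le_mul_left d hF3
    rcases hsat with hα | hβ
    · subst hα
      have hs : s = ma := by omega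
      subst hs
      refine lt_of_not_ge fun hcon => ?_
      nlinarith [hcon, hF1, hF2, hd, hμ']
    · subst hβ
      have hα1 : α ≤ 1 := by omega
      rcases Nat.le_one_iff_eq_zero_or_eq_one.mp hα1 with hα | hα
      · subst hα
        have hs : s = ma := by omega
        subst hs
        refine lt_of_not_ge fun hcon => ?_
        nlinarith [hcon, hF1, hF2, hd, hμ']
      · subst hα
        have hs : s + 1 = ma := by omega
        have hmg2 : mg = s + 2 := by omega
        refine lt_of_not_ge fun hcon => ?_
        have heG : eG ≤ s + 2 := hmg2 ▸ hF4
        nlinarith [hcon, hF1, hF2, hd, hμ', heG, hs]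

/-- **`OStep0`** — at a chart-1 successor at `c = 0` of an isolated BAD node `θ` with `linearPart θ = 0`
(type O), an isolated successor `θ'` has strictly smaller Milnor number.  Proof = strict transforms
(`exists_strict_transform`) + `x`-adic bookkeeping (`X_pow_cancel`: `s = min (ma, mg − 2)`) + the colength
identity + Max Noether's inequality (`noether_inequality`) + `ostep_arith`. [OURS · L1 W4.5c] -/
theorem milnor_lt_of_isSuccChart1_zero (θ θ' : PlanarField κ) (hiso : θ.IsIsolated) (hbad : θ.IsBadNode)
    (hL : θ.linearPart = 0) (hsucc : IsSuccChart1 0 θ θ') (hiso' : θ'.IsIsolated) :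
    θ'.milnor < θ.milnor := by
  obtain ⟨hsing, -⟩ := hbad
  obtain ⟨ha0, hb0⟩ := ne_zero_of_isIsolated θ hiso hsing
  obtain ⟨h2a, h2b⟩ := (linearPart_eq_zero_iff_two_le_order θ hsing).mp hL
  have hg0 : X 0 * θ.b - X 1 * θ.a ≠ 0 := X_mul_sub_ne_zero θ hiso h2a
  -- strict transforms of `a`, `b`, `g := x b − y a`
  obtain ⟨A, hA, hKA, hνA⟩ := exists_strict_transform ha0
  obtain ⟨Bst, hB, hKB, hνB⟩ := exists_strict_transform hb0
  obtain ⟨G, hG, hKG, hνG⟩ := exists_strict_transform hg0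
  have hord := min_order_add_one_le θ.a θ.b
  set ma := θ.a.order.toNat with hma_def
  set mb := θ.b.order.toNat with hmb_def
  set mg := (X 0 * θ.b - X 1 * θ.a).order.toNat with hmg_def
  have hma : (ma : ℕ∞) = θ.a.order := ne_zero_iff_order_finite.mp ha0
  have hmb : (mb : ℕ∞) = θ.b.order := ne_zero_iff_order_finite.mp hb0
  have hmg : (mg : ℕ∞) = (X 0 * θ.b - X 1 * θ.a).order := ne_zero_iff_order_finite.mp hg0
  have h2a' : 2 ≤ ma := by rw [← hma] at h2a; exact_mod_cast h2a
  have h2b' : 2 ≤ mb := by rw [← hmb] at h2b; exact_mod_cast h2b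
  have hmgb : min ma mb + 1 ≤ mg := by
    rw [← hma, ← hmb, ← hmg] at hord
    rcases le_total ma mb with h | h
    · rw [min_eq_left h]
      rw [min_eq_left (Nat.cast_le.mpr h : (ma : ℕ∞) ≤ mb)] at hord
      exact_mod_cast hord
    · rw [min_eq_right h]
      rw [min_eq_right (Nat.cast_le.mpr h : (mb : ℕ∞) ≤ ma)] at hord
      exact_mod_cast hord
  have hxA : ¬ (X 0 : MvPowerSeries (Fin 2) κ) ∣ A := (killCompl_ne_zero_iff_not_X_dvd A).mp hKA
  have hxG : ¬ (X 0 : MvPowerSeries (Fin 2) κ) ∣ G := (killCompl_ne_zero_iff_not_X_dvd G).mp hKG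
  -- `fA = ord A(0,y) ≤ ma`, `eG = ord G(0,y) ≤ mg`
  obtain ⟨-, hfA⟩ := colength_X_eq_order hKA
  obtain ⟨-, heG⟩ := colength_X_eq_order hKG
  have hfA' : Module.finrank κ (MvPowerSeries (Fin 2) κ ⧸ Ideal.span {A, (X 0 : MvPowerSeries (Fin 2) κ)}) =
      (killCompl (⟨fun _ => (1 : Fin 2), fun a b _ => Subsingleton.elim a b⟩ : Fin 1 ↪ Fin 2) A).order.toNat := by
    rw [Ideal.span_pair_comm]; exact hfA
  have heG' : Module.finrank κ (MvPowerSeries (Fin 2) κ ⧸ Ideal.span {G, (X 0 : MvPowerSeries (Fin 2) κ)}) =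
      (killCompl (⟨fun _ => (1 : Fin 2), fun a b _ => Subsingleton.elim a b⟩ : Fin 1 ↪ Fin 2) G).order.toNat := by
    rw [Ideal.span_pair_comm]; exact heG
  have hF3 : Module.finrank κ (MvPowerSeries (Fin 2) κ ⧸ Ideal.span {A, (X 0 : MvPowerSeries (Fin 2) κ)}) ≤ ma := by
    rw [hfA']; exact ENat.toNat_le_of_le_coe hνA
  have hF4 : Module.finrank κ (MvPowerSeries (Fin 2) κ ⧸ Ideal.span {G, (X 0 : MvPowerSeries (Fin 2) κ)}) ≤ mg := by
    rw [heG']; exact ENat.toNat_le_of_le_coe hνG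
  -- the successor equations
  obtain ⟨s, h1, h2, hsat⟩ := hsucc
  have h2' := isSuccChart1_zero_eq θ θ' h2
  rw [chart1_zero_eq_blow, hA] at h1
  rw [chart1_zero_eq_blow, hG] at h2'
  obtain ⟨hs_ma, ha'⟩ := X_pow_cancel hxA h1
  obtain ⟨hs_mg, hb'⟩ := X_pow_cancel hxG h2'
  set α := ma - s with hα_def
  set β := mg - (s + 2) with hβ_def
  have hsα : s + α = ma := by omega
  have hsβ : s + 2 + β = mg := by omega
  have hsat' : α = 0 ∨ β = 0 := by
    rcases Nat.eq_zero_or_pos α with hα | hα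
    · exact Or.inl hα
    rcases Nat.eq_zero_or_pos β with hβ | hβ
    · exact Or.inr hβ
    exfalso
    apply hsat
    constructor
    · rw [ha']; exact Dvd.dvd.mul_right (dvd_pow_self (X 0) hα.ne') A
    · rw [hb']; exact Dvd.dvd.mul_right (dvd_pow_self (X 0) hβ.ne') G
  -- the key identity `x^(mg-1) G = x^mb B* − y x^ma A`
  have htr := X_zero_mul_transform θ.a θ.b
  rw [chart1_zero_eq_blow, hA, hB, hG] at htr
  have hid : X 0 ^ (s + 1 + β) * G = X 0 ^ mb * Bst - X 1 * X 0 ^ ma * A := by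
    apply mul_left_cancel₀ (X_zero_ne_zero (κ := κ))
    calc X 0 * (X 0 ^ (s + 1 + β) * G) = X 0 ^ mg * G := by rw [← hsβ]; ring
      _ = X 0 * (X 0 ^ mb * Bst - X 1 * (X 0 ^ ma * A)) := htr.symm
      _ = X 0 * (X 0 ^ mb * Bst - X 1 * X 0 ^ ma * A) := by ring
  -- `μ(θ')` by colength additivity, in both saturation cases
  have key : Module.Finite κ (MvPowerSeries (Fin 2) κ ⧸ Ideal.span {A, G}) ∧
      θ'.milnor = α * Module.finrank κ (MvPowerSeries (Fin 2) κ ⧸ Ideal.span {G, (X 0 : MvPowerSeries (Fin 2) κ)}) +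
        β * Module.finrank κ (MvPowerSeries (Fin 2) κ ⧸ Ideal.span {A, (X 0 : MvPowerSeries (Fin 2) κ)}) +
        Module.finrank κ (MvPowerSeries (Fin 2) κ ⧸ Ideal.span {A, G}) := by
    rcases hsat' with hα | hβ
    · -- α = 0 : `a' = A`, `b' = x^β G`
      have ha'' : θ'.a = A := by rw [ha', hα, pow_zero, one_mul]
      have hfin' : Module.Finite κ (MvPowerSeries (Fin 2) κ ⧸ Ideal.span {A, X 0 ^ β * G}) := by
        have h := hiso'
        unfold IsIsolated at h
        rwa [ha'', hb'] at h
      obtain ⟨hfinAG, hcol⟩ := colength_X_pow_mul hxA β hfin'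
      refine ⟨hfinAG, ?_⟩
      show Module.finrank κ (MvPowerSeries (Fin 2) κ ⧸ Ideal.span {θ'.a, θ'.b}) = _
      rw [ha'', hb', hcol, hα, zero_mul, zero_add]
    · -- β = 0 : `a' = x^α A`, `b' = G`
      have hb'' : θ'.b = G := by rw [hb', hβ, pow_zero, one_mul]
      have hfin' : Module.Finite κ (MvPowerSeries (Fin 2) κ ⧸ Ideal.span {G, X 0 ^ α * A}) := by
        have h := hiso'
        unfold IsIsolated at h
        rwa [ha', hb'', Ideal.span_pair_comm] at h
      obtain ⟨hfinGA, hcol⟩ := colength_X_pow_mul hxG α hfin'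
      have hfinAG : Module.Finite κ (MvPowerSeries (Fin 2) κ ⧸ Ideal.span {A, G}) := by
        rw [Ideal.span_pair_comm]; exact hfinGA
      refine ⟨hfinAG, ?_⟩
      show Module.finrank κ (MvPowerSeries (Fin 2) κ ⧸ Ideal.span {θ'.a, θ'.b}) = _
      rw [ha', hb'', Ideal.span_pair_comm, hcol, hβ, zero_mul, add_zero, Ideal.span_pair_comm (x := G) (y := A)]
  obtain ⟨hfinAG, hμ'⟩ := key
  -- colength identity and Noether
  obtain ⟨hfinAB, hF2⟩ := colength_identity hKA hid hfinAG
  have hF1 : Module.finrank κ (MvPowerSeries (Fin 2) κ ⧸ Ideal.span {A, Bst}) + ma * mb ≤ θ.milnor :=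
    noether_inequality (mf := ma) (mg := mb) hma.le hmb.le hA hB hKA
      (hνA.trans (by exact_mod_cast Nat.le_add_right ma mb)) hiso hfinAB
  -- case N2 data: if `mb < ma` then `mg = mb + 1` and `G(0,y) = B*(0,y)`
  have hN2 : mb < ma → mg = mb + 1 ∧
      Module.finrank κ (MvPowerSeries (Fin 2) κ ⧸ Ideal.span {G, (X 0 : MvPowerSeries (Fin 2) κ)}) ≤ mb := by
    intro hlt
    have hmb1 : mb + 1 ≤ mg := by rw [min_eq_right hlt.le] at hmgb; exact hmgb
    obtain ⟨t, ht⟩ : ∃ t, s + 1 + β = mb + t := ⟨s + 1 + β - mb, by omega⟩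
    obtain ⟨d, hd⟩ : ∃ d, ma = mb + (d + 1) := ⟨ma - mb - 1, by omega⟩
    have hid' : X 0 ^ t * G = Bst - X 1 * X 0 ^ (d + 1) * A := by
      apply mul_left_cancel₀ (pow_ne_zero mb (X_zero_ne_zero (κ := κ)))
      calc X 0 ^ mb * (X 0 ^ t * G) = X 0 ^ (s + 1 + β) * G := by rw [ht, pow_add, mul_assoc]
        _ = X 0 ^ mb * Bst - X 1 * X 0 ^ ma * A := hid
        _ = X 0 ^ mb * (Bst - X 1 * X 0 ^ (d + 1) * A) := by rw [hd, pow_add]; ring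
    have h0 : (0 : Fin 2) ∉ Set.range (⟨fun _ => (1 : Fin 2), fun a b _ => Subsingleton.elim a b⟩ : Fin 1 ↪ Fin 2) :=
      fun ⟨i, hi⟩ => by simp at hi
    have hK := congrArg (killCompl (R := κ) (⟨fun _ => (1 : Fin 2), fun a b _ => Subsingleton.elim a b⟩ : Fin 1 ↪ Fin 2)) hid'
    simp only [map_mul, map_pow, map_sub, killCompl_X_eq_zero h0, zero_pow (Nat.succ_ne_zero d), mul_zero,
      zero_mul, sub_zero] at hK
    rcases Nat.eq_zero_or_pos t with ht0 | htpos
    · rw [ht0, pow_zero, one_mul] at hK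
      refine ⟨by omega, ?_⟩
      rw [heG', hK]
      exact ENat.toNat_le_of_le_coe hνB
    · exfalso
      rw [zero_pow htpos.ne', zero_mul] at hK
      exact hKB hK.symm
  exact ostep_arith h2a' h2b' hmgb hsα hsβ hsat' hF1 hF2 hF3 hF4 hN2 hμ'


/-! ## Part III — the support `OStep` for an ARBITRARY successor, via the B3 transport toolkit
(`forall_isSucc_of_chart1_zero` + the shear/swap invariances of `S1PlanarFieldTransport`). [OURS · L1 W4.5c] -/

/-- **`OStep`** (= `W1NCascade.OStep` unfolded): at ANY successor of an isolated bad node of type O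
(`linearPart = 0`), an isolated successor has strictly smaller Milnor number. [OURS · L1 W4.5c] -/
theorem milnor_lt_of_isSucc (θ θ' : PlanarField κ) (hiso : θ.IsIsolated) (hbad : θ.IsBadNode)
    (hL : θ.linearPart = 0) (hsucc : θ.IsSucc θ') (hiso' : θ'.IsIsolated) : θ'.milnor < θ.milnor := by
  revert hiso hbad hL hiso'
  refine forall_isSucc_of_chart1_zero
    (P := fun θ θ' => θ.IsIsolated → θ.IsBadNode → θ.linearPart = 0 → θ'.IsIsolated → θ'.milnor < θ.milnor)
    ?_ ?_ ?_ θ θ' hsucc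
  · intro c θ θ' h hiso hbad hL hiso'
    have := h ((isIsolated_shear_iff c θ).mpr hiso) ((isBadNode_shear_iff c θ).mpr hbad)
      ((linearPart_shear_eq_zero_iff c θ).mpr hL) hiso'
    rwa [milnor_shear] at this
  · intro θ θ' h hiso hbad hL hiso'
    have := h ((isIsolated_swapField_iff θ).mpr hiso) ((isBadNode_swapField_iff θ).mpr hbad)
      ((linearPart_swapField_eq_zero_iff θ).mpr hL) ((isIsolated_swapField_iff θ').mpr hiso')
    rwa [milnor_swapField, milnor_swapField] at this
  · intro θ θ' h hiso hbad hL hiso'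
    exact milnor_lt_of_isSuccChart1_zero θ θ' hiso hbad hL h hiso'

end Summit.ResolutionOfSingularities.ResolutionOfSingularities.Theorems.WildQuotientResolution.S1.PlanarField

end
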